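import Literature.AnabelianGeometry.AbsoluteAnabelian.RelativeGrothendieckConjecture
import Literature.AnabelianGeometry.AbsoluteAnabelian.AbsTopIII.KummerFaithfulSubpadicProofs
import Literature.AnabelianGeometry.AbsoluteAnabelian.SlimOfTorallyKummerFaithfulProofs
import Literature.AnabelianGeometry.AbsoluteAnabelian.PadicGaussValuation
import HarnessLib

/-!
# [pGC] Lemma 15.8 (Tamagawa / Mochizuki): `Γ_K` is slim, hence center-free, for every sub-`p`-adic
# field `K` — UNCONDITIONAL kernel proof (no Theorem A, no class field theory)

S. Mochizuki, *The local pro-`p` anabelian geometry of curves* (1999) [pGC], Lemma 15.8 p. 80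
("Let `K` be sub-`p`-adic. Then `Γ_K` is center-free"; due to A. Tamagawa, proved there through
Corollary 15.3 = Theorem A for once-punctured elliptic curves), in the forms typed in the cell file
`RelativeGrothendieckConjecture.lean` (abc-iut-L4-t13): `pGC.Lem_15_8` (center-free) and
`pGC.Lem_15_8_slim` (the form [AbsTopI] Ex. 4.8 (ii) p. 58 quotes: "the absolute Galois group of a
sub-`p`-adic field is always slim").  Both were FACT-policy rows (FOUNDATIONS row 16/25); this
proof-only file DISCHARGES them:

* `pGC.lem_15_8_slim_holds : pGC.Lem_15_8_slim` — by the slimness engine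
  `isSlimGroup_absoluteGaloisGroup_of_isTorallyKummerFaithful` (Kummer theory + the norm, file
  `SlimOfTorallyKummerFaithfulProofs`) fed with (a) toral Kummer-faithfulness of sub-`p`-adic fields
  ([AbsTopIII] Rmk. 1.5.4 (i) torus half, `IsSubpadic.isTorallyKummerFaithful`) and (b) a
  homomorphism `K^× → ℤ` non-trivial at `p`, the restriction along `K ↪ L` of the one on the
  finitely generated extension `L/ℚ_p` built in `PadicGaussValuation` (transcendence basis, norm to
  `ℚ_p(t)`, `p`-order);
* `pGC.lem_15_8_holds : pGC.Lem_15_8` — slim ⟹ center-free.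

HONEST FRAMING: a classical-style elementary proof (ours) of a refereed statement; nothing here
bears on [IUTchIII] Cor. 3.12. [cite: MochizukiLocAn1999, Lem 15.8 p.80]
-/

noncomputable section

open scoped Classical

namespace Literature.AnabelianGeometry.AbsoluteAnabelian

open Field
open Literature.AlgebraicGeometry.Frobenioids (IsSlimGroup)
open AbsTopIII

universe u

/-- **[pGC] Lemma 15.8, slim form ([AbsTopI] Ex. 4.8 (ii)) — DISCHARGED**: the absolute Galois group of
a sub-`p`-adic field is slim. [cite: MochizukiLocAn1999, Lem 15.8 p.80] -/
theorem pGC.lem_15_8_slim_holds : pGC.Lem_15_8_slim.{u} := by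
  intro K _ hK
  have hKF : IsTorallyKummerFaithful K := hK.isTorallyKummerFaithful
  haveI : CharZero K := hKF.charZero
  obtain ⟨p, hp, hKp⟩ := hK.exists_prime
  obtain ⟨L, _, _, hfg, ⟨ι⟩⟩ := hKp.exists_embedding
  haveI : Algebra.EssFiniteType ℚ_[p] L := IntermediateField.fg_top_iff.mp hfg
  haveI : CharZero L := charZero_of_injective_algebraMap (algebraMap ℚ_[p] L).injective
  obtain ⟨w, hw⟩ := exists_unitsHom_of_essFiniteType p L
  have hpK : (p : K) ≠ 0 := by exact_mod_cast hp.out.ne_zero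
  have hpL : (p : L) ≠ 0 := by exact_mod_cast hp.out.ne_zero
  refine isSlimGroup_absoluteGaloisGroup_of_isTorallyKummerFaithful hKF
    (w.comp (Units.map (ι : K →* L))) (Units.mk0 (p : K) hpK) ?_
  have hmap : Units.map (ι : K →* L) (Units.mk0 (p : K) hpK) = Units.mk0 (p : L) hpL :=
    Units.ext (by simp)
  rw [MonoidHom.comp_apply, hmap]
  exact hw hpL

/-- **[pGC] Lemma 15.8 — DISCHARGED**: "Let `K` be sub-`p`-adic. Then `Γ_K` is center-free."
(The centre is contained in the centraliser of the open subgroup `Γ_K` itself.)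
[cite: MochizukiLocAn1999, Lem 15.8 p.80] -/
theorem pGC.lem_15_8_holds : pGC.Lem_15_8.{u} := by
  intro K _ hK
  have h := (pGC.lem_15_8_slim_holds K hK).centralizer_eq_bot ⊤ isOpen_univ
  rw [eq_bot_iff] at h ⊢
  intro z hz
  refine h ?_
  rw [Subgroup.mem_centralizer_iff]
  intro g _
  exact (Subgroup.mem_center_iff.mp hz) g

/-- Hence also the slim form of [Tpcs] Lemma 4.14 quoted in [AbsTopI] Ex. 4.8 (ii) needs no input
for SUB-`p`-adic fields: `G_K` slim for every field receiving no more than an embedding into a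
finitely generated extension of `ℚ_p`; in particular for every MLF and every number field
(cf. `galoisMLF_slim_holds`, `galoisNF_slim_holds`). Restated for convenience over `IsSubpadicFor`.
[cite: MochizukiLocAn1999, Lem 15.8 p.80] -/
theorem IsSubpadicFor.isSlimGroup_absoluteGaloisGroup {K : Type u} [Field K] {p : ℕ} [Fact p.Prime]
    (h : IsSubpadicFor K p) : IsSlimGroup (absoluteGaloisGroup K) :=
  pGC.lem_15_8_slim_holds K ⟨⟨p, inferInstance, h⟩⟩

end Literature.AnabelianGeometry.AbsoluteAnabelian
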